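import Mathlib
import HarnessLib
import Summits.HubbardSuperconductivity.HubbardSuperconductivity.Theorems.KLProgrammeKLRegimeVolumeLimitMatsubaraResolvent

/-!
# Volume-uniform spatial decay of the fermionic Matsubara coefficients of anticommuting odd single-site pairs on the Hubbard torus
# — for EVERY coupling (seat hubbard-kl-k3c5-p3 g6, technique «OS-positivity-free direct assembly»; VL child of K3, `--supports` stmt-…-19921)

Route `KLProgramme`, crux K3, child VOLUME-LIMIT.  Second file of «the one-volume momentum modulus (M) of the VL carrier is SOFT».  With
`…VolumeLimitMatsubaraResolvent` (the transfer theorem `norm_fermionic_matsubara_le_of_anticommutator_bound`) and the tree's anticommutator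
light cone on the torus (`norm_anticommutator_hubbardTorus_le`, HubbardThermalFermionDecayProofs — Hastings 2004), for the grand-canonical
Hubbard torus `H = hubbardTorusWith 2 L 1 U μ` at inverse temperature `β > 0`:

* §1 `matsubara_sum_left/right` — finite-sum linearity of `X, Y ↦ ∫₀^β e^{ikτ}⟨X(τ)Y⟩`;
* §2 `norm_anticommutator_hubbardTorus_le_of_norm_le` — the tree's single-site light cone for operators of arbitrary norms `a, b` (scaling);
* §3 **`norm_matsubara_singleSite_le`** — for odd `A ∈ 𝔄_{x}`, odd `B ∈ 𝔄_{y}` with `{A,B} = 0`, `‖A‖ ≤ a`, `‖B‖ ≤ b`, and a fermionic `k`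
  with `|k| ≥ π/β`: `‖∫₀^β e^{ikτ}⟨A(τ)B⟩‖ ≤ a·b·(5β/π)·exp(−γ·dist(x,y))`, `γ = min(1/2, π/(8κβ))`, `κ = 36eJ`, `J = 2 + |U| + 2|μ|` —
  UNIFORM in the volume `L` and in the label `k` (the light cone is an operator-norm bound; the state enters through `|⟨Y⟩| ≤ ‖Y‖` only):
  majorant `F(t) = ab·(e^{−d/2} + 2e^{(π/2β)t − πd/(8κβ)})` of `‖{τ_{±t}(A), B}‖` (light cone `ab·36Je·t·e^{κt−d} ≤ ab·e^{2κt−d}` up to `t = d/(4κ)`,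
  the trivial `2ab` beyond), then `∫₀^∞ e^{−|k|t}F ≤ ab(β/π)(e^{−d/2} + 4e^{−πd/(8κβ)})`.

Next file (`…VolumeLimitDressedModeDecay`): the dressed site modes of k3c5-p1's `T′`, the radial lattice sum, and the momentum modulus of
`𝒵′(k,p) = ∫₀^β e^{ikτ}⟨T′_{−p}(τ)T′_{−p}†⟩`.  Everything is proved; no definition.
-/

noncomputable section

namespace Summit.HubbardSuperconductivity.HubbardSuperconductivity.Theorems.ThermalGreen

set_option linter.dupNamespace false -- summit = problem name (single-conjunct summit), D-0017

open scoped Matrix.Norms.L2Operator ComplexConjugate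
open Matrix Complex MeasureTheory intervalIntegral Finset Literature.MathematicalPhysics.QuantumLattice Literature.Probability.LatticeModels

/-! ## §1 Finite-sum linearity of the Matsubara transform -/

section Generic

variable {n : Type*} [Fintype n] [DecidableEq n]

/-- `∫₀^β e^{ikτ}⟨(Σ_i c_i X_i)(τ)·Y⟩ = Σ_i c_i ∫₀^β e^{ikτ}⟨X_i(τ)·Y⟩`. -/
theorem matsubara_sum_left {ι : Type*} (β : ℝ) (H : Matrix n n ℂ) (s : Finset ι) (c : ι → ℂ) (X : ι → Matrix n n ℂ)
    (Y : Matrix n n ℂ) (k : ℝ) :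
    ∫ τ in (0 : ℝ)..β, cexp (I * k * τ) * gibbsState β H (imagTimeEvolve H (τ : ℂ) (∑ i ∈ s, c i • X i) * Y) =
      ∑ i ∈ s, c i * ∫ τ in (0 : ℝ)..β, cexp (I * k * τ) * gibbsState β H (imagTimeEvolve H (τ : ℂ) (X i) * Y) := by
  classical
  induction s using Finset.induction_on with
  | empty =>
    simp only [Finset.sum_empty, imagTimeEvolve_eq, Matrix.zero_mul, map_zero, mul_zero,
      intervalIntegral.integral_zero]
  | insert a s ha ih =>
    rw [Finset.sum_insert ha, Finset.sum_insert ha]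
    have h := matsubara_lin_left β H (X a) (∑ i ∈ s, c i • X i) Y (c a) 1 k
    rw [one_smul, one_mul] at h
    rw [h, ih]

/-- `∫₀^β e^{ikτ}⟨X(τ)·(Σ_i c_i Y_i)⟩ = Σ_i c_i ∫₀^β e^{ikτ}⟨X(τ)·Y_i⟩`. -/
theorem matsubara_sum_right {ι : Type*} (β : ℝ) (H : Matrix n n ℂ) (s : Finset ι) (c : ι → ℂ) (X : Matrix n n ℂ)
    (Y : ι → Matrix n n ℂ) (k : ℝ) :
    ∫ τ in (0 : ℝ)..β, cexp (I * k * τ) * gibbsState β H (imagTimeEvolve H (τ : ℂ) X * ∑ i ∈ s, c i • Y i) =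
      ∑ i ∈ s, c i * ∫ τ in (0 : ℝ)..β, cexp (I * k * τ) * gibbsState β H (imagTimeEvolve H (τ : ℂ) X * Y i) := by
  classical
  induction s using Finset.induction_on with
  | empty =>
    simp only [Finset.sum_empty, map_zero, mul_zero, intervalIntegral.integral_zero]
  | insert a s ha ih =>
    rw [Finset.sum_insert ha, Finset.sum_insert ha]
    have h := matsubara_lin_right β H X (Y a) (∑ i ∈ s, c i • Y i) (c a) 1 k
    rw [one_smul, one_mul] at h
    rw [h, ih]

end Generic

/-! ## §2 The single-site anticommutator light cone for operators of arbitrary norm -/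

section CarGeneric

variable {ι : Type*} [LinearOrder ι] [Fintype ι]

/-- Scalar multiples stay in a CAR subalgebra (generic orbital type, so that the instance path is the generic one). -/
theorem smul_mem_carSubalgebra {S : Finset ι} {A : Matrix (Finset ι) (Finset ι) ℂ} (hA : A ∈ carSubalgebra S) (c : ℂ) :
    c • A ∈ carSubalgebra S :=
  Subalgebra.smul_mem _ hA c

end CarGeneric

section Torus

variable {L : ℕ} [NeZero L]

/-- **The tree's torus light cone, scaled**: for `A ∈ 𝔄_{x}` odd, `B ∈ 𝔄_{y}`, `‖A‖ ≤ a`, `‖B‖ ≤ b` (`a, b > 0`), `s ≥ 0`: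
`‖{τ_s(A), B}‖ ≤ ‖{A,B}‖ + a·b·36Je·s·e^{κs − dist(x,y)}` (`norm_anticommutator_hubbardTorus_le` applied to `A/a`, `B/b`). -/
theorem norm_anticommutator_hubbardTorus_le_of_norm_le [instDE : DecidableEq (FermionTorus 2 L)] (U μ : ℝ) (x y : TorusSite 2 L)
    {A B : Matrix (Finset (Orb (FermionTorus 2 L))) (Finset (Orb (FermionTorus 2 L))) ℂ}
    (hA : A ∈ carSubalgebra (orbSet ({FermionTorus.ofTorusSite x} : Finset (FermionTorus 2 L))))
    (hB : B ∈ carSubalgebra (orbSet ({FermionTorus.ofTorusSite y} : Finset (FermionTorus 2 L))))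
    (hAodd : parityOp * A = -(A * parityOp)) {a b : ℝ} (ha : 0 < a) (hb : 0 < b) (hA1 : ‖A‖ ≤ a) (hB1 : ‖B‖ ≤ b)
    {s : ℝ} (hs : 0 ≤ s) :
    ‖heisenbergEvolution (hubbardTorusWith 2 L 1 U μ) s A * B + B * heisenbergEvolution (hubbardTorusWith 2 L 1 U μ) s A‖ ≤
      ‖A * B + B * A‖ + a * b * (36 * (2 * |(1 : ℝ)| + |U| + 2 * |μ|) * Real.exp 1 * s *
        Real.exp (Real.exp 1 * (2 * (2 * |(1 : ℝ)| + |U| + 2 * |μ|) * (2 * (2 * 4 + 1) : ℕ)) * s - torusDist x y)) := by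
  -- instance bookkeeping (see `norm_anticommutator_hubbardTorus_le`)
  obtain rfl : instDE = LinearOrder.toDecidableEq := Subsingleton.elim _ _
  letI instDE : DecidableEq (FermionTorus 2 L) := LinearOrder.toDecidableEq
  set H := hubbardTorusWith 2 L 1 U μ with hH
  set A' : Matrix (Finset (Orb (FermionTorus 2 L))) (Finset (Orb (FermionTorus 2 L))) ℂ := ((a⁻¹ : ℝ) : ℂ) • A with hA'
  set B' : Matrix (Finset (Orb (FermionTorus 2 L))) (Finset (Orb (FermionTorus 2 L))) ℂ := ((b⁻¹ : ℝ) : ℂ) • B with hB'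
  have hA'mem : A' ∈ carSubalgebra (orbSet ({FermionTorus.ofTorusSite x} : Finset (FermionTorus 2 L))) :=
    smul_mem_carSubalgebra hA _
  have hB'mem : B' ∈ carSubalgebra (orbSet ({FermionTorus.ofTorusSite y} : Finset (FermionTorus 2 L))) :=
    smul_mem_carSubalgebra hB _
  have hA'odd : parityOp * A' = -(A' * parityOp) := by
    rw [hA', Matrix.mul_smul, Matrix.smul_mul, hAodd, smul_neg]
  have hna : ‖((a⁻¹ : ℝ) : ℂ)‖ = a⁻¹ := by rw [Complex.norm_real, Real.norm_of_nonneg (inv_nonneg.mpr ha.le)]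
  have hnb : ‖((b⁻¹ : ℝ) : ℂ)‖ = b⁻¹ := by rw [Complex.norm_real, Real.norm_of_nonneg (inv_nonneg.mpr hb.le)]
  have hA'1 : ‖A'‖ ≤ 1 := by
    rw [hA', norm_smul, hna, inv_mul_le_iff₀ ha, mul_one]; exact hA1
  have hB'1 : ‖B'‖ ≤ 1 := by
    rw [hB', norm_smul, hnb, inv_mul_le_iff₀ hb, mul_one]; exact hB1
  have h := norm_anticommutator_hubbardTorus_le U μ x y hA'mem hB'mem hA'odd hA'1 hB'1 hs
  have hev : heisenbergEvolution H s A' = ((a⁻¹ : ℝ) : ℂ) • heisenbergEvolution H s A := by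
    simp only [hA', heisenbergEvolution, Matrix.mul_smul, Matrix.smul_mul]
  have hanti : heisenbergEvolution H s A' * B' + B' * heisenbergEvolution H s A' =
      (((a⁻¹ : ℝ) : ℂ) * ((b⁻¹ : ℝ) : ℂ)) • (heisenbergEvolution H s A * B + B * heisenbergEvolution H s A) := by
    rw [hev, hB']
    simp only [Matrix.smul_mul, Matrix.mul_smul, smul_smul, smul_add, mul_comm]
  have hAB' : A' * B' + B' * A' = (((a⁻¹ : ℝ) : ℂ) * ((b⁻¹ : ℝ) : ℂ)) • (A * B + B * A) := by
    rw [hA', hB']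
    simp only [Matrix.smul_mul, Matrix.mul_smul, smul_smul, smul_add, mul_comm]
  rw [← hH, hanti, hAB', norm_smul, norm_smul, norm_mul, hna, hnb] at h
  have hab : 0 < a * b := mul_pos ha hb
  have key := mul_le_mul_of_nonneg_left h hab.le
  rw [mul_add] at key
  have e1 : a * b * (a⁻¹ * b⁻¹ * ‖heisenbergEvolution H s A * B + B * heisenbergEvolution H s A‖) =
      ‖heisenbergEvolution H s A * B + B * heisenbergEvolution H s A‖ := by
    field_simp
  have e2 : a * b * (a⁻¹ * b⁻¹ * ‖A * B + B * A‖) = ‖A * B + B * A‖ := by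
    field_simp
  rw [e1, e2] at key
  exact key

/-- `‖{τ_t(A), B}‖ ≤ 2‖A‖‖B‖` (the trivial bound; `H` Hermitian). -/
theorem norm_anticommutator_heisenbergEvolution_le_two_mul {m : Type*} [Fintype m] [DecidableEq m] {H : Matrix m m ℂ}
    (hH : H.IsHermitian) (t : ℝ) (A B : Matrix m m ℂ) :
    ‖heisenbergEvolution H t A * B + B * heisenbergEvolution H t A‖ ≤ 2 * (‖A‖ * ‖B‖) := by
  have h1 : ‖heisenbergEvolution H t A * B‖ ≤ ‖A‖ * ‖B‖ :=
    (norm_mul_le _ _).trans (by rw [norm_heisenbergEvolution_holds hH])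
  have h2 : ‖B * heisenbergEvolution H t A‖ ≤ ‖A‖ * ‖B‖ :=
    (norm_mul_le _ _).trans (by rw [norm_heisenbergEvolution_holds hH, mul_comm])
  exact (norm_add_le _ _).trans (by linarith)

/-! ## §3 Volume-uniform decay of the Matsubara coefficients of anticommuting odd single-site pairs -/

/-- **`‖∫₀^β e^{ikτ}⟨A(τ)B⟩_H‖ ≤ a·b·(5β/π)·exp(−γ·dist(x,y))`** for `H = hubbardTorusWith 2 L 1 U μ`, `β > 0`, odd single-site operators
`A ∈ 𝔄_{x}`, `B ∈ 𝔄_{y}` with `{A, B} = 0`, `‖A‖ ≤ a`, `‖B‖ ≤ b`, and a fermionic frequency `k` (`e^{ikβ} = −1`) with `|k| ≥ π/β`; here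
`γ = min(1/2, π/(8κβ))`, `κ = e·2J·18`, `J = 2|1| + |U| + 2|μ|` — independent of `L`, `k`, `x`, `y`.  (Transfer theorem with the majorant
`F(t) = ab·(e^{−d/2} + 2e^{(π/2β)t − πd/(8κβ)})` of `‖{τ_{±t}(A), B}‖`: the light cone `ab·36Je·t·e^{κt−d} ≤ ab·e^{2κt−d}` up to `t = d/(4κ)`, the
trivial bound `2ab` beyond.) -/
theorem norm_matsubara_singleSite_le [instDE : DecidableEq (FermionTorus 2 L)] (U μ : ℝ) {β : ℝ} (hβ : 0 < β) (x y : TorusSite 2 L)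
    {A B : Matrix (Finset (Orb (FermionTorus 2 L))) (Finset (Orb (FermionTorus 2 L))) ℂ}
    (hA : A ∈ carSubalgebra (orbSet ({FermionTorus.ofTorusSite x} : Finset (FermionTorus 2 L))))
    (hB : B ∈ carSubalgebra (orbSet ({FermionTorus.ofTorusSite y} : Finset (FermionTorus 2 L))))
    (hAodd : parityOp * A = -(A * parityOp)) (hBodd : parityOp * B = -(B * parityOp))
    {a b : ℝ} (ha : 0 < a) (hb : 0 < b) (hA1 : ‖A‖ ≤ a) (hB1 : ‖B‖ ≤ b) (hAB : A * B + B * A = 0)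
    {k : ℝ} (hk : cexp (I * k * β) = -1) (hka : Real.pi / β ≤ |k|) :
    ‖∫ τ in (0 : ℝ)..β, cexp (I * k * τ) * gibbsState β (hubbardTorusWith 2 L 1 U μ)
        (imagTimeEvolve (hubbardTorusWith 2 L 1 U μ) (τ : ℂ) A * B)‖ ≤
      a * b * (5 * β / Real.pi) *
        Real.exp (-(min (1 / 2 : ℝ) (Real.pi / (8 * (Real.exp 1 * (2 * (2 * |(1 : ℝ)| + |U| + 2 * |μ|) * (2 * (2 * 4 + 1) : ℕ))) * β)) *
          torusDist x y)) := by
  -- instance bookkeeping (see `norm_anticommutator_hubbardTorus_le`)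
  obtain rfl : instDE = LinearOrder.toDecidableEq := Subsingleton.elim _ _
  letI instDE : DecidableEq (FermionTorus 2 L) := LinearOrder.toDecidableEq
  haveI : Nonempty (Finset (Orb (FermionTorus 2 L))) := ⟨∅⟩
  set H := hubbardTorusWith 2 L 1 U μ with hH_def
  have hH : H.IsHermitian := isHermitian_hamiltonianWith (fermionTorusGraph 2 L) 1 U μ
  set J : ℝ := 2 * |(1 : ℝ)| + |U| + 2 * |μ| with hJ
  set κ : ℝ := Real.exp 1 * (2 * J * (2 * (2 * 4 + 1) : ℕ)) with hκ
  have hJpos : 0 < J := by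
    have h1 : |(1 : ℝ)| = 1 := abs_one
    have := abs_nonneg U; have := abs_nonneg μ; rw [hJ]; linarith
  have hκpos : 0 < κ := by positivity
  have hKκ : 36 * J * Real.exp 1 = κ := by
    rw [hκ]; norm_num; ring
  set d : ℝ := (torusDist x y : ℝ) with hd
  have hd0 : 0 ≤ d := Nat.cast_nonneg _
  set a₀ : ℝ := Real.pi / β with ha₀_def
  have ha₀ : 0 < a₀ := div_pos Real.pi_pos hβ
  have hk0 : a₀ ≤ |k| := hka
  have hkpos : 0 < |k| := lt_of_lt_of_le ha₀ hk0
  set γ : ℝ := min (1 / 2 : ℝ) (Real.pi / (8 * κ * β)) with hγ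
  -- the majorant
  set F : ℝ → ℝ := fun t => a * b * (Real.exp (-(d / 2)) + 2 * Real.exp (a₀ / 2 * t - a₀ * d / (8 * κ))) with hF
  have hFnn : ∀ t, 0 ≤ F t := fun t => by positivity
  -- light cone in closed form, both time directions
  have hLC : ∀ t, 0 ≤ t → ‖heisenbergEvolution H t A * B + B * heisenbergEvolution H t A‖ ≤
      a * b * (36 * J * Real.exp 1 * t * Real.exp (κ * t - d)) := by
    intro t ht
    have h := norm_anticommutator_hubbardTorus_le_of_norm_le U μ x y hA hB hAodd ha hb hA1 hB1 ht
    rw [hAB, norm_zero, zero_add] at h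
    exact h
  have hLC' : ∀ t, 0 ≤ t → ‖heisenbergEvolution H (-t) A * B + B * heisenbergEvolution H (-t) A‖ ≤
      a * b * (36 * J * Real.exp 1 * t * Real.exp (κ * t - d)) := by
    intro t ht
    rw [norm_anticommutator_heisenbergEvolution_neg hH]
    have hBA : B * A + A * B = 0 := by rw [add_comm]; exact hAB
    have h := norm_anticommutator_hubbardTorus_le_of_norm_le U μ y x hB hA hBodd hb ha hB1 hA1 ht
    rw [hBA, norm_zero, zero_add, torusDist_comm_holds y x, mul_comm b a] at h
    exact h
  -- the closed form is dominated by `F`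
  have hdom : ∀ t, 0 ≤ t → ∀ v : ℝ, v ≤ a * b * (36 * J * Real.exp 1 * t * Real.exp (κ * t - d)) → v ≤ 2 * (a * b) → v ≤ F t := by
    intro t ht v hv1 hv2
    rw [hF]; dsimp only
    by_cases hcase : κ * t ≤ d / 4
    · -- inside: `36Je·t·e^{κt−d} ≤ e^{2κt−d} ≤ e^{−d/2}`
      have h1 : 36 * J * Real.exp 1 * t * Real.exp (κ * t - d) ≤ Real.exp (-(d / 2)) := by
        have hκt : κ * t ≤ Real.exp (κ * t) := by
          have := Real.add_one_le_exp (κ * t); linarith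
        calc 36 * J * Real.exp 1 * t * Real.exp (κ * t - d)
            = (κ * t) * Real.exp (κ * t - d) := by rw [← hKκ]
          _ ≤ Real.exp (κ * t) * Real.exp (κ * t - d) :=
              mul_le_mul_of_nonneg_right hκt (Real.exp_pos _).le
          _ = Real.exp (2 * (κ * t) - d) := by rw [show 2 * (κ * t) - d = κ * t + (κ * t - d) by ring, Real.exp_add]
          _ ≤ Real.exp (-(d / 2)) := Real.exp_le_exp.mpr (by linarith)
      have h2 : a * b * (36 * J * Real.exp 1 * t * Real.exp (κ * t - d)) ≤ a * b * Real.exp (-(d / 2)) :=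
        mul_le_mul_of_nonneg_left h1 (mul_pos ha hb).le
      have h3 : 0 ≤ a * b * (2 * Real.exp (a₀ / 2 * t - a₀ * d / (8 * κ))) := by positivity
      linarith
    · -- outside: the trivial bound `2ab ≤ 2ab·e^{(a₀/2)(t − d/(4κ))}`
      push Not at hcase
      have hexp : 1 ≤ Real.exp (a₀ / 2 * t - a₀ * d / (8 * κ)) := by
        rw [← Real.exp_zero]
        refine Real.exp_le_exp.mpr ?_
        have : a₀ / 2 * t - a₀ * d / (8 * κ) = a₀ / (8 * κ) * (4 * (κ * t) - d) := by field_simp; ring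
        rw [this]
        exact mul_nonneg (by positivity) (by linarith)
      have h2 : 2 * (a * b) ≤ a * b * (2 * Real.exp (a₀ / 2 * t - a₀ * d / (8 * κ))) := by
        have := mul_le_mul_of_nonneg_left hexp (by positivity : 0 ≤ 2 * (a * b)); linarith
      have h3 : 0 ≤ a * b * Real.exp (-(d / 2)) := by positivity
      linarith
  have hAB1 : ‖A‖ * ‖B‖ ≤ a * b := mul_le_mul hA1 hB1 (norm_nonneg B) ha.le
  have hFge : ∀ t, 0 ≤ t → ‖heisenbergEvolution H t A * B + B * heisenbergEvolution H t A‖ ≤ F t := fun t ht =>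
    hdom t ht _ (hLC t ht) ((norm_anticommutator_heisenbergEvolution_le_two_mul hH t A B).trans (by linarith))
  have hFge' : ∀ t, 0 ≤ t → ‖heisenbergEvolution H (-t) A * B + B * heisenbergEvolution H (-t) A‖ ≤ F t := fun t ht =>
    hdom t ht _ (hLC' t ht) ((norm_anticommutator_heisenbergEvolution_le_two_mul hH (-t) A B).trans (by linarith))
  -- integrability of `e^{-|k| t} F(t)` on `(0, ∞)` and the value of a dominating integral
  have hc₂ : a₀ / 2 - |k| < 0 := by linarith
  have hsplit : ∀ t, Real.exp (-(|k| * t)) * F t =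
      a * b * Real.exp (-(d / 2)) * Real.exp (-|k| * t) +
        2 * (a * b) * Real.exp (-(a₀ * d / (8 * κ))) * Real.exp ((a₀ / 2 - |k|) * t) := by
    intro t
    rw [hF]; dsimp only
    have e1 : Real.exp (a₀ / 2 * t - a₀ * d / (8 * κ)) = Real.exp (-(a₀ * d / (8 * κ))) * Real.exp (a₀ / 2 * t) := by
      rw [← Real.exp_add]; ring_nf
    have e2 : Real.exp ((a₀ / 2 - |k|) * t) = Real.exp (a₀ / 2 * t) * Real.exp (-(|k| * t)) := by
      rw [← Real.exp_add]; ring_nf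
    rw [e1, e2, neg_mul]
    ring
  have hI1 : IntegrableOn (fun t => a * b * Real.exp (-(d / 2)) * Real.exp (-|k| * t)) (Set.Ioi 0) :=
    (exp_neg_integrableOn_Ioi 0 hkpos).const_mul _
  have hI2 : IntegrableOn (fun t => 2 * (a * b) * Real.exp (-(a₀ * d / (8 * κ))) * Real.exp ((a₀ / 2 - |k|) * t)) (Set.Ioi 0) :=
    (integrableOn_exp_mul_Ioi hc₂ 0).const_mul _
  have hFint : IntegrableOn (fun t => Real.exp (-(|k| * t)) * F t) (Set.Ioi 0) := by
    have := hI1.add hI2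
    refine this.congr_fun (fun t _ => (hsplit t).symm) measurableSet_Ioi
  -- the transfer theorem
  have hmain := norm_fermionic_matsubara_le_of_anticommutator_bound hH hβ A B hk hFge hFge' hFint
  refine hmain.trans ?_
  -- evaluate the dominating integral
  have hval : ∫ t in Set.Ioi 0, Real.exp (-(|k| * t)) * F t =
      a * b * Real.exp (-(d / 2)) * (1 / |k|) + 2 * (a * b) * Real.exp (-(a₀ * d / (8 * κ))) * (1 / (|k| - a₀ / 2)) := by
    rw [setIntegral_congr_fun measurableSet_Ioi (fun t _ => hsplit t), integral_add hI1 hI2, MeasureTheory.integral_const_mul,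
      MeasureTheory.integral_const_mul]
    have i1 : ∫ t in Set.Ioi 0, Real.exp (-|k| * t) = 1 / |k| := by
      rw [integral_exp_mul_Ioi (by linarith : -|k| < 0) 0, mul_zero, Real.exp_zero, neg_div, ← div_neg, neg_neg]
    have i2 : ∫ t in Set.Ioi 0, Real.exp ((a₀ / 2 - |k|) * t) = 1 / (|k| - a₀ / 2) := by
      rw [integral_exp_mul_Ioi hc₂ 0, mul_zero, Real.exp_zero, neg_div, ← div_neg, neg_sub]
    rw [i1, i2]
  rw [hval]
  -- `1/|k| ≤ β/π`, `1/(|k| − a₀/2) ≤ 2β/π`, and both exponentials `≤ e^{−γ d}`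
  have hk1 : 1 / |k| ≤ β / Real.pi := by
    rw [div_le_div_iff₀ hkpos Real.pi_pos, one_mul]
    have : Real.pi / β * β ≤ |k| * β := mul_le_mul_of_nonneg_right hk0 hβ.le
    rwa [div_mul_cancel₀ _ hβ.ne', mul_comm] at this
  have hk2 : 1 / (|k| - a₀ / 2) ≤ 2 * β / Real.pi := by
    have hden : 0 < |k| - a₀ / 2 := by linarith
    rw [div_le_div_iff₀ hden Real.pi_pos, one_mul]
    have : a₀ / 2 ≤ |k| - a₀ / 2 := by linarith
    have h2 : a₀ / 2 * (2 * β) ≤ (|k| - a₀ / 2) * (2 * β) := mul_le_mul_of_nonneg_right this (by positivity)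
    have e : a₀ / 2 * (2 * β) = Real.pi := by rw [ha₀_def]; field_simp
    linarith
  have hγ1 : Real.exp (-(d / 2)) ≤ Real.exp (-(γ * d)) := by
    refine Real.exp_le_exp.mpr (neg_le_neg ?_)
    calc γ * d ≤ (1 / 2) * d := mul_le_mul_of_nonneg_right (min_le_left _ _) hd0
      _ = d / 2 := by ring
  have hγ2 : Real.exp (-(a₀ * d / (8 * κ))) ≤ Real.exp (-(γ * d)) := by
    refine Real.exp_le_exp.mpr (neg_le_neg ?_)
    calc γ * d ≤ Real.pi / (8 * κ * β) * d := mul_le_mul_of_nonneg_right (min_le_right _ _) hd0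
      _ = a₀ * d / (8 * κ) := by rw [ha₀_def]; field_simp
  have hab : 0 ≤ a * b := (mul_pos ha hb).le
  have hden : 0 ≤ 1 / (|k| - a₀ / 2) := by
    have : 0 < |k| - a₀ / 2 := by linarith
    positivity
  have T1 : a * b * Real.exp (-(d / 2)) * (1 / |k|) ≤ a * b * Real.exp (-(γ * d)) * (β / Real.pi) :=
    mul_le_mul (mul_le_mul_of_nonneg_left hγ1 hab) hk1 (by positivity) (by positivity)
  have T2 : 2 * (a * b) * Real.exp (-(a₀ * d / (8 * κ))) * (1 / (|k| - a₀ / 2)) ≤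
      2 * (a * b) * Real.exp (-(γ * d)) * (2 * β / Real.pi) :=
    mul_le_mul (mul_le_mul_of_nonneg_left hγ2 (by positivity)) hk2 hden (by positivity)
  calc a * b * Real.exp (-(d / 2)) * (1 / |k|) + 2 * (a * b) * Real.exp (-(a₀ * d / (8 * κ))) * (1 / (|k| - a₀ / 2))
      ≤ a * b * Real.exp (-(γ * d)) * (β / Real.pi) + 2 * (a * b) * Real.exp (-(γ * d)) * (2 * β / Real.pi) := add_le_add T1 T2
    _ = a * b * (5 * β / Real.pi) * Real.exp (-(γ * d)) := by ring

end Torus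

end Summit.HubbardSuperconductivity.HubbardSuperconductivity.Theorems.ThermalGreen

end
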